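import Summits.BirchSwinnertonDyer.BirchSwinnertonDyer.Theorems.AdditiveKolyvaginRoadRamifiedHabitatSignLawInertAnyLevel
import Summits.BirchSwinnertonDyer.BirchSwinnertonDyer.Theorems.AdditiveKolyvaginRoadRamifiedHabitatSignLawAnyLevelSketch
import Summits.BirchSwinnertonDyer.BirchSwinnertonDyer.Theorems.AdditiveKolyvaginRoadRamifiedHabitatSupply
import Summits.BirchSwinnertonDyer.BirchSwinnertonDyer.Theorems.AdditiveKolyvaginRoadRamifiedHabitatSupplyInert
import Literature.NumberTheory.DiophantineGeometry.ConductorMultiplicativeProofs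
import Literature.NumberTheory.EllipticCurves.ShortWeierstrassGoodTwistLocalProofs
import HarnessLib

/-!
# Route `AdditiveKolyvaginRoad`, crux KS′ `LevelKolyvaginSystemsAdditive` (stmt-BirchSwinnertonDyer-21396), card `ramified-toric-habitat` —
# SIGNED HABITATS EXIST: every supercuspidal additive row has a `p`-ramified habitat of sign `+1` (definite algebra `B_{p∞}`), and — given one
# odd multiplicative prime — one of sign `−1` (Shimura curve `X^{pq₀}`)

Cell `pub/bsd-wall`, width seat `bsd-wall-akr-p2x-w2` g12; `--supports stmt-BirchSwinnertonDyer-21396` (helper). THEOREMS ONLY; no definition,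
no named fact, no `sorry`. BSD is not proved by any of this; KS′/KPA′ stay OPEN at `p² ∣ N`.

Composition BY NAME of akr-p2x-w4 g6's habitat SUPPLY (`RamifiedHabitat.exists_ramifiedHabitat`, `…exists_ramifiedHabitat_inert`: the card's
habitats are never empty — Dirichlet + CRT) with the any-level SIGN LAWS of this seat (`…SignLawAnyLevelSketch`, `…SignLawInertAnyLevel`):

* §21 `exists_ramifiedHabitat_rootNumber_mul_eq_one` — `W` global minimal, `p ≥ 5`, `Addv W p`, `¬ W.semistabilityDefectAt p ∣ p − 1` ⟹ for
  every bound `n` there is an imaginary quadratic `K′` with `d_{K′}` odd, `p ∣ d_{K′}`, `d_{K′} < −n`, `d_{K′} < −4`, every other bad prime of `W`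
  split in `K′`, AND `w(E)·w(E^{(d_{K′})}) = +1` (card T3: the analytic-rank-`0` rows — `w(E) = +1` — live on the definite algebra `B_{p∞}` over
  such a `K′`, INCLUDING the rows with no multiplicative prime at all).
* §22 `ramifiedHabitat_data_of_discr_of_jacobiSym_ne_zero` (the integer data `d = p*·d'` for a habitat whose odd bad primes are merely
  UNRAMIFIED, `(d/q) ≠ 0`), `rootNumber_mul_rootNumber_twist_discr_of_one_inert_eq_neg_one_of_addv_of_not_semistabilityDefectAt_dvd` (field
  form of the one-inert law in the sketch's binders) and `exists_ramifiedHabitat_inert_rootNumber_mul_eq_neg_one` — same row PLUS one odd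
  multiplicative prime `q₀ ≠ p` of `W` ⟹ a habitat `K′` as above but with `q₀` INERT and `w(E)·w(E^{(d_{K′})}) = −1` (the analytic-rank-`1`
  rows — `w(E) = −1` — live on the Shimura curve `X^{pq₀}`; the crux's ♯ frames have two multiplicative primes, so `q₀` odd is available).

Everything for `E` with ARBITRARY reduction away from `p`; CONDITIONAL on the Modularity Theorem and Kellock–Dokchitser's Rem. 2.2 at `p` for `E`,
`E^{(p*)}` (named facts). BSD is not proved by any of this.

References: [cite: Rohrlich1993Compositio, Prop. 2(iv)] [cite: KellockDokchitser2023, Rem. 2.2] [cite: Serre1972, §5.6 (p. 312)]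
[cite: SilvermanATAEC1994, IV.10.2 (b)].
-/

set_option autoImplicit false
set_option linter.dupNamespace false

noncomputable section

open scoped Classical MatrixGroups NumberTheorySymbols

open CongruenceSubgroup IsDedekindDomain IsDedekindDomain.HeightOneSpectrum NumberField Rat.HeightOneSpectrum
  WeierstrassCurve Literature.NumberTheory.EllipticCurves Literature.NumberTheory.EllipticCurves.ModularForms
  IsDiscreteValuationRing

namespace Summit.BirchSwinnertonDyer.BirchSwinnertonDyer.Theorems.AdditiveKoly.RamifiedHabitat

open Literature.NumberTheory.EllipticCurves.Rank1Residual Summit.BirchSwinnertonDyer.Rank1Residual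
  Summit.BirchSwinnertonDyer.Rank1Residual.Additive

/-! ## §21 The definite habitat exists on every supercuspidal additive row -/

section Definite

variable {p : ℕ} [hp : Fact p.Prime]

/-- **EVERY SUPERCUSPIDAL ADDITIVE ROW HAS A `p`-RAMIFIED HABITAT OF SIGN `+1`.** `W/ℚ` global minimal, `p ≥ 5` additive (`Addv W p`) with
`¬ W.semistabilityDefectAt p ∣ p − 1`; then for every `n` there is an imaginary quadratic field `K′` with `d_{K′}` odd, `p ∣ d_{K′}`, `d_{K′} < −n`,
`d_{K′} < −4`, every other bad prime of `W` split in `K′` (the sketch's `OtherBadPrimesSplit`, spelled out), and `w(E)·w(E^{(d_{K′})}) = +1`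
(w4 g6's `exists_ramifiedHabitat` + `rootNumber_mul_rootNumber_twist_discr_eq_one_of_addv_of_not_semistabilityDefectAt_dvd`). For `E` with
ARBITRARY reduction off `p` — in particular for the rank-`0` rows `E^{(d_K)}` with no multiplicative prime. Conditional on {hmod, F1 at `p`};
BSD is not proved by this. [cite: Rohrlich1993Compositio, Prop. 2(iv)] [cite: KellockDokchitser2023, Rem. 2.2] -/
theorem exists_ramifiedHabitat_rootNumber_mul_eq_one (W : WeierstrassCurve ℚ) [W.IsElliptic] [W.IsGloballyMinimal]
    (hmod : exists_isNewformOf) (hF1 : W.atkinLehnerEigenvalueAt_eq_localRootNumberAt)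
    (hF1' : (W.quadraticTwist (((-1 : ℤ) ^ (p / 2) * p : ℤ) : ℚ)).atkinLehnerEigenvalueAt_eq_localRootNumberAt)
    (hp5 : 5 ≤ p) (hadd : Addv W p) (hsc : ¬ W.semistabilityDefectAt p ∣ p - 1) (n : ℕ) :
    ∃ (K : Type) (_ : Field K) (_ : NumberField K),
      IsImaginaryQuadratic K ∧ Odd (NumberField.discr K) ∧ (p : ℤ) ∣ NumberField.discr K ∧
      NumberField.discr K < -(n : ℤ) ∧ NumberField.discr K < -4 ∧
      (∀ q : ℕ, q.Prime → (q : ℤ) ∣ (W.conductorNorm ℤ : ℤ) → q ≠ p →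
        (q ≠ 2 → jacobiSym (NumberField.discr K) q = 1) ∧ (q = 2 → NumberField.discr K % 8 = 1)) ∧
      W.rootNumber * (W.quadraticTwist (NumberField.discr K : ℚ)).rootNumber = 1 := by
  obtain ⟨K, _, _, hK, -, hodd, hpd, hn, h4, hsplit⟩ := exists_ramifiedHabitat W p (by omega) n
  exact ⟨K, inferInstance, inferInstance, hK, hodd, hpd, hn, h4, hsplit,
    rootNumber_mul_rootNumber_twist_discr_eq_one_of_addv_of_not_semistabilityDefectAt_dvd W hmod hF1 hF1' hp5 hadd hsc K hK hodd hpd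
      hsplit⟩

end Definite

/-! ## §22 The Shimura-curve habitat exists on every supercuspidal additive row with an odd multiplicative prime -/

section Shimura

variable {p : ℕ} [hp : Fact p.Prime]

/-- **The habitat as a field when the odd primes of `M` are merely UNRAMIFIED in `K′`** (`(d/q) ≠ 0`, split OR inert): for an imaginary quadratic
`K′` with ODD discriminant `d` divisible by `p`, `M ≠ 0` prime to … nothing assumed …, the cofactor `d'` has `d = p*·d'`, `d' ≡ 1 (4)` squarefree,
`(d', M p²) = 1`, `p*·d' < 0` (as `ramifiedHabitat_data_of_discr_anyLevel`, whose split hypothesis was only used for `q ∤ d`; at `q = 2`: `d` is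
odd). [cite: SilvermanAEC2009, X.2 and App. C §16] -/
theorem ramifiedHabitat_data_of_discr_of_jacobiSym_ne_zero {M : ℕ} (hp2 : p ≠ 2) (hM0 : M ≠ 0)
    (K : Type) [Field K] [NumberField K] (hK : IsImaginaryQuadratic K) (hKodd : Odd (NumberField.discr K))
    (hpd : (p : ℤ) ∣ NumberField.discr K)
    (hunr : ∀ q ∈ M.primeFactors, q ≠ 2 → J(NumberField.discr K | q) ≠ 0) :
    ∃ d' : ℤ, NumberField.discr K = (-1 : ℤ) ^ (p / 2) * p * d' ∧ d' % 4 = 1 ∧ Squarefree d' ∧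
      Int.gcd d' (M * p ^ 2 : ℕ) = 1 ∧ (-1 : ℤ) ^ (p / 2) * p * d' < 0 := by
  have hpP : p.Prime := hp.out
  set d := NumberField.discr K with hd
  obtain ⟨hd4, hdsq⟩ : d % 4 = 1 ∧ Squarefree d := by
    rcases Literature.NumberTheory.QuadraticFields.Quadratic.isFundamentalDiscriminant_discr (K := K) hK.1 with
      ⟨h4, hsq, -⟩ | ⟨h4, -, -⟩
    · exact ⟨h4, hsq⟩
    · exfalso
      obtain ⟨k, hk⟩ := h4
      obtain ⟨m, hm⟩ := hKodd
      omega
  have hdneg : d < 0 := IsImaginaryQuadratic.discr_neg hK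
  obtain ⟨k, hk⟩ := hpd
  set s : ℤ := (-1 : ℤ) ^ (p / 2) with hs
  have hs2 : s * s = 1 := by
    rw [hs, ← pow_two, ← pow_mul]
    exact Even.neg_one_pow ⟨p / 2, by ring⟩
  have hdeq : d = s * p * (s * k) := by
    calc d = (s * s) * (p * k) := by rw [hs2, one_mul, hk]
      _ = s * p * (s * k) := by ring
  refine ⟨s * k, hdeq, ?_, ?_, ?_, ?_⟩
  · have hp' := (Nat.Prime.eq_two_or_odd hpP).resolve_left hp2
    have hpk : (p * k) % 4 = 1 := by rw [← hk]; exact hd4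
    rw [Int.mul_emod] at hpk
    rcases Nat.odd_mod_four_iff.mp hp' with hp4 | hp4
    · rw [hs, ZMod.neg_one_pow_div_two_of_one_mod_four hp4, one_mul]
      have : (p : ℤ) % 4 = 1 := by exact_mod_cast hp4
      rw [this, one_mul, Int.emod_emod_of_dvd _ (by norm_num : (4 : ℤ) ∣ 4)] at hpk
      exact hpk
    · rw [hs, ZMod.neg_one_pow_div_two_of_three_mod_four hp4]
      have : (p : ℤ) % 4 = 3 := by exact_mod_cast hp4
      rw [this] at hpk
      omega
  · exact hdsq.squarefree_of_dvd ⟨s * p, by rw [hk]; linear_combination (-(p * k)) * hs2⟩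
  · rw [← Int.isCoprime_iff_gcd_eq_one]
    push_cast
    refine IsCoprime.mul_right ?_ (IsCoprime.pow_right ?_)
    · have hMprod : (M : ℤ) = ∏ q ∈ M.primeFactors, (q : ℤ) ^ M.factorization q := by
        conv_lhs => rw [Nat.prod_primeFactors_pow_factorization hM0]
        push_cast
        rfl
      rw [hMprod]
      refine IsCoprime.prod_right fun q hq ↦ IsCoprime.pow_right ?_
      have hqp : q.Prime := Nat.prime_of_mem_primeFactors hq
      have hqZ : Prime (q : ℤ) := Nat.prime_iff_prime_int.mp hqp
      refine (Prime.coprime_iff_not_dvd hqZ).mpr (fun hqd' ↦ ?_) |>.symm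
      have hqd : (q : ℤ) ∣ d := by rw [hdeq]; exact Dvd.dvd.mul_left hqd' _
      by_cases hq2 : q = 2
      · subst hq2
        obtain ⟨m, hm⟩ := hKodd
        obtain ⟨c, hc⟩ := hqd
        omega
      · haveI : NeZero q := ⟨hqp.ne_zero⟩
        exact hunr q hq hq2 (jacobiSym.eq_zero_iff_not_coprime.mpr (by
          intro hc
          have hc' : IsCoprime d (q : ℤ) := Int.isCoprime_iff_gcd_eq_one.mpr hc
          exact hqZ.not_unit (hc'.isUnit_of_dvd' hqd (dvd_refl _))))
    · have hpZ : Prime (p : ℤ) := Nat.prime_iff_prime_int.mp hpP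
      refine (Prime.coprime_iff_not_dvd hpZ).mpr (fun hpd' ↦ ?_) |>.symm
      have : (p : ℤ) * p ∣ d := by rw [hdeq]; exact mul_dvd_mul (dvd_mul_left _ _) hpd'
      exact hpP.ne_one (by
        have hu := hdsq (p : ℤ) this
        exact_mod_cast Int.isUnit_iff_natAbs_eq.mp hu)
  · rw [← hdeq]; exact hdneg

/-- `q ∥ N_W` at a prime of multiplicative reduction (Silverman *ATAEC* IV.10.2 (b): `f_q = 1`; tree `conductorExponent_eq_one_iff_holds`,
`factorization_conductorNorm_eq_conductorExponent`). [cite: SilvermanATAEC1994, IV.10.2 (b)] -/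
theorem factorization_conductorNorm_eq_one_of_hasMultiplicativeReductionAtPrime (W : WeierstrassCurve ℚ) [W.IsElliptic]
    (q : ℕ) [hq : Fact q.Prime] (hm : W.HasMultiplicativeReductionAtPrime q) : (W.conductorNorm ℤ).factorization q = 1 := by
  obtain ⟨v, hv⟩ : ∃ v : HeightOneSpectrum (𝓞 ℚ), (primesEquiv v : ℕ) = q :=
    ⟨primesEquiv.symm ⟨q, hq.out⟩, by rw [Equiv.apply_symm_apply]⟩
  subst hv
  have e1 := (W.hasMultiplicativeReductionAtPrime_iff_hasMultiplicativeReductionAt_ringOfIntegers v).mp hm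
  have e2 : W.conductorExponent v = 1 ↔ W.HasMultiplicativeReductionAt v := conductorExponent_eq_one_iff_holds v W
  have e3 := factorization_conductorNorm_eq_conductorExponent W (primesEquiv v)
  rw [Equiv.symm_apply_apply] at e3
  rw [e3]
  exact e2.mpr e1

/-- **SHIMURA-CURVE HABITAT IN THE SKETCH'S BINDERS (field form of the one-inert law).** `W/ℚ` global minimal, `p ≥ 5` additive with
`¬ W.semistabilityDefectAt p ∣ p − 1` (supercuspidal), `q₀ ≠ 2, p` a prime of MULTIPLICATIVE reduction of `W`, `K′` imaginary quadratic with
`d_{K′}` odd, `p ∣ d_{K′}`, `q₀` INERT (`(d_{K′}/q₀) = −1`) and every bad prime `q ∉ {p, q₀}` split (`(d_{K′}/q) = 1`, `d_{K′} ≡ 1 (8)` if `q = 2`).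
Then `w(E)·w(E^{(d_{K′})}) = −1`. No cofactor / `ord_p Δ` / `c₄` hypothesis (as in `…SignLawAnyLevelSketch`); `v_{q₀}(N) = 1` supplies the odd
exponent of `…SignLawInertAnyLevel`. Conditional on {hmod, F1 at `p`}; BSD is not proved by this.
[cite: Serre1972, §5.6 (p. 312)] [cite: Rohrlich1993Compositio, Prop. 2(iv)] [cite: KellockDokchitser2023, Rem. 2.2] [cite: SilvermanATAEC1994, IV.10.2 (b)] -/
theorem rootNumber_mul_rootNumber_twist_discr_of_one_inert_eq_neg_one_of_addv_of_not_semistabilityDefectAt_dvd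
    (W : WeierstrassCurve ℚ) [W.IsElliptic] [W.IsGloballyMinimal]
    (hmod : exists_isNewformOf) (hF1 : W.atkinLehnerEigenvalueAt_eq_localRootNumberAt)
    (hF1' : (W.quadraticTwist (((-1 : ℤ) ^ (p / 2) * p : ℤ) : ℚ)).atkinLehnerEigenvalueAt_eq_localRootNumberAt)
    (hp5 : 5 ≤ p) (hadd : Addv W p) (hsc : ¬ W.semistabilityDefectAt p ∣ p - 1)
    {q₀ : ℕ} (hq₀ : q₀.Prime) (hq₀2 : q₀ ≠ 2) (hq₀p : q₀ ≠ p)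
    (hmult : haveI := Fact.mk hq₀; W.HasMultiplicativeReductionAtPrime q₀)
    (K : Type) [Field K] [NumberField K] (hK : IsImaginaryQuadratic K) (hKodd : Odd (NumberField.discr K))
    (hpd : (p : ℤ) ∣ NumberField.discr K) (hinert : jacobiSym (NumberField.discr K) q₀ = -1)
    (hsplit : ∀ q : ℕ, q.Prime → (q : ℤ) ∣ (W.conductorNorm ℤ : ℤ) → q ≠ p → q ≠ q₀ →
      (q ≠ 2 → jacobiSym (NumberField.discr K) q = 1) ∧ (q = 2 → NumberField.discr K % 8 = 1)) :
    W.rootNumber * (W.quadraticTwist (NumberField.discr K : ℚ)).rootNumber = -1 := by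
  have hpP : p.Prime := hp.out
  have hp2 : p ≠ 2 := by omega
  haveI := Fact.mk hq₀
  -- `N = M p²`, `p ∤ M`, `v_{q₀}(M) = 1`
  obtain ⟨hN, hpM⟩ := conductorNorm_eq_div_mul_sq_of_addv W hp5 hadd
  set M : ℕ := W.conductorNorm ℤ / p ^ 2 with hM
  have hM0 : M ≠ 0 := by
    intro h; rw [h, zero_mul] at hN; exact (W.conductorNorm_pos_holds).ne' hN
  have hfacN : (W.conductorNorm ℤ).factorization q₀ = 1 := factorization_conductorNorm_eq_one_of_hasMultiplicativeReductionAtPrime W q₀ hmult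
  have hfacM : M.factorization q₀ = 1 := by
    have h := hfacN
    rw [hN, Nat.factorization_mul hM0 (pow_ne_zero 2 hpP.ne_zero), Finsupp.add_apply, hpP.factorization_pow, Finsupp.single_apply,
      if_neg (Ne.symm hq₀p), add_zero] at h
    exact h
  have hq₀M : q₀ ∈ M.primeFactors := by
    refine Nat.mem_primeFactors.mpr ⟨hq₀, ?_, hM0⟩
    have h1 : q₀ ^ 1 ∣ M := (hq₀.pow_dvd_iff_le_factorization hM0).mpr (by rw [hfacM])
    rwa [pow_one] at h1
  -- the primes of `M` in the conductor
  have hqN : ∀ q ∈ M.primeFactors, (q : ℤ) ∣ (W.conductorNorm ℤ : ℤ) ∧ q ≠ p := fun q hq ↦ by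
    refine ⟨?_, ?_⟩
    · rw [hN]; push_cast
      exact Dvd.dvd.mul_right (by exact_mod_cast Nat.dvd_of_mem_primeFactors hq) _
    · rintro rfl; exact hpM (Nat.dvd_of_mem_primeFactors hq)
  have hodd : ∀ q ∈ M.primeFactors, q ≠ q₀ → q ≠ 2 → J(NumberField.discr K | q) = 1 := fun q hq hqq₀ hq2 ↦
    (hsplit q (Nat.prime_of_mem_primeFactors hq) (hqN q hq).1 (hqN q hq).2 hqq₀).1 hq2
  have htwo : 2 ∣ M → NumberField.discr K % 8 = 1 := fun h2 ↦ by
    have h2M : 2 ∈ M.primeFactors := Nat.mem_primeFactors.mpr ⟨Nat.prime_two, h2, hM0⟩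
    exact (hsplit 2 Nat.prime_two (hqN 2 h2M).1 (hqN 2 h2M).2 (Ne.symm hq₀2)).2 rfl
  have hunr : ∀ q ∈ M.primeFactors, q ≠ 2 → J(NumberField.discr K | q) ≠ 0 := fun q hq hq2 ↦ by
    by_cases hqq₀ : q = q₀
    · rw [hqq₀, hinert]; norm_num
    · rw [hodd q hq hqq₀ hq2]; norm_num
  -- the integer data of the habitat
  obtain ⟨d', hd, hd'4, hd'sq, hgcd, hneg⟩ := ramifiedHabitat_data_of_discr_of_jacobiSym_ne_zero (p := p) hp2 hM0 K hK hKodd hpd hunr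
  -- potentially good, the census list of `ord_p Δ_min`, `p ∣ c₄`
  have hj0 : 0 ≤ padicValRat p W.j := by
    by_contra h
    exact hsc (SemistabilityDefect.semistabilityDefectAt_dvd_sub_one_of_addv_of_subM W p hp5 hadd (not_le.mp h))
  have hdef := SemistabilityDefect.semistabilityDefectAt_eq_semistabilityIndex W p hp5 hj0
  rw [hdef] at hsc
  change ¬ 12 / Nat.gcd 12 (padicValInt p W.minimalDiscriminantInt) ∣ p - 1 at hsc
  rw [Nat.gcd_comm] at hsc
  have hmem := padicValInt_minimalDiscriminantInt_mem_of_addv_of_padicValRat_j_nonneg W p hp5 hadd hj0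
  have ha : padicValInt p W.minimalDiscriminantInt = 2 ∨ padicValInt p W.minimalDiscriminantInt = 3 ∨
      padicValInt p W.minimalDiscriminantInt = 4 ∨ padicValInt p W.minimalDiscriminantInt = 8 ∨
      padicValInt p W.minimalDiscriminantInt = 9 ∨ padicValInt p W.minimalDiscriminantInt = 10 := by
    rcases hmem with h | h | h | h | h | h | h
    · exact Or.inl h
    · exact Or.inr (Or.inl h)
    · exact Or.inr (Or.inr (Or.inl h))
    · exfalso
      rw [h, show 12 / Nat.gcd 6 12 = 2 by decide] at hsc
      have hp' := (Nat.Prime.eq_two_or_odd hpP).resolve_left hp2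
      exact hsc (by omega)
    · exact Or.inr (Or.inr (Or.inr (Or.inl h)))
    · exact Or.inr (Or.inr (Or.inr (Or.inr (Or.inl h))))
    · exact Or.inr (Or.inr (Or.inr (Or.inr (Or.inr h))))
  obtain ⟨hΔ', hc₄', hj'⟩ := localHypotheses_of_isGloballyMinimal (p := p) W (dvd_c₄_integralModelInt_of_addv W hadd)
    (c₄_eq_zero_or_le_of_padicValRat_j_nonneg W hj0)
  -- the one-inert law (any `M`)
  rw [hd] at hodd htwo hinert ⊢
  rw [← hN] at hgcd
  exact rootNumber_mul_rootNumber_ramifiedTwist_of_one_inert_anyLevel_eq_neg_one_of_not_dvd W hmod hF1 hF1' hp5 hN hpM hΔ' ha hc₄' hj'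
    hd'4 hd'sq hgcd hneg hq₀M hq₀2 (by rw [hfacM]; exact odd_one) hinert hodd htwo hsc

/-- **EVERY SUPERCUSPIDAL ADDITIVE ROW WITH AN ODD MULTIPLICATIVE PRIME HAS A `p`-RAMIFIED HABITAT OF SIGN `−1`.** `W/ℚ` global minimal,
`p ≥ 5` additive with `¬ W.semistabilityDefectAt p ∣ p − 1`, `q₀ ≠ 2, p` a prime of multiplicative reduction; then for every `n` there is an
imaginary quadratic `K′` with `d_{K′}` odd, `p ∣ d_{K′}`, `d_{K′} < −n`, `d_{K′} < −4`, `q₀` INERT, every bad prime `∉ {p, q₀}` split, and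
`w(E)·w(E^{(d_{K′})}) = −1` (w4 g6's `exists_ramifiedHabitat_inert` + the previous theorem): the card's Shimura-curve habitat `X^{pq₀}` for the
analytic-rank-`1` rows is never empty and has the right sign, for `E` with ARBITRARY reduction off `p`. Conditional on {hmod, F1 at `p`};
BSD is not proved by this. [cite: Rohrlich1993Compositio, Prop. 2(iv)] [cite: KellockDokchitser2023, Rem. 2.2] -/
theorem exists_ramifiedHabitat_inert_rootNumber_mul_eq_neg_one (W : WeierstrassCurve ℚ) [W.IsElliptic] [W.IsGloballyMinimal]
    (hmod : exists_isNewformOf) (hF1 : W.atkinLehnerEigenvalueAt_eq_localRootNumberAt)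
    (hF1' : (W.quadraticTwist (((-1 : ℤ) ^ (p / 2) * p : ℤ) : ℚ)).atkinLehnerEigenvalueAt_eq_localRootNumberAt)
    (hp5 : 5 ≤ p) (hadd : Addv W p) (hsc : ¬ W.semistabilityDefectAt p ∣ p - 1)
    {q₀ : ℕ} (hq₀ : q₀.Prime) (hq₀2 : q₀ ≠ 2) (hq₀p : q₀ ≠ p)
    (hmult : haveI := Fact.mk hq₀; W.HasMultiplicativeReductionAtPrime q₀) (n : ℕ) :
    ∃ (K : Type) (_ : Field K) (_ : NumberField K),
      IsImaginaryQuadratic K ∧ Odd (NumberField.discr K) ∧ (p : ℤ) ∣ NumberField.discr K ∧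
      NumberField.discr K < -(n : ℤ) ∧ NumberField.discr K < -4 ∧
      jacobiSym (NumberField.discr K) q₀ = -1 ∧
      (∀ q : ℕ, q.Prime → (q : ℤ) ∣ (W.conductorNorm ℤ : ℤ) → q ≠ p → q ≠ q₀ →
        (q ≠ 2 → jacobiSym (NumberField.discr K) q = 1) ∧ (q = 2 → NumberField.discr K % 8 = 1)) ∧
      W.rootNumber * (W.quadraticTwist (NumberField.discr K : ℚ)).rootNumber = -1 := by
  obtain ⟨K, _, _, hK, -, hodd, hpd, hn, h4, hinert, hsplit⟩ := exists_ramifiedHabitat_inert W p (by omega) q₀ hq₀ hq₀2 hq₀p n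
  exact ⟨K, inferInstance, inferInstance, hK, hodd, hpd, hn, h4, hinert, hsplit,
    rootNumber_mul_rootNumber_twist_discr_of_one_inert_eq_neg_one_of_addv_of_not_semistabilityDefectAt_dvd W hmod hF1 hF1' hp5 hadd hsc
      hq₀ hq₀2 hq₀p hmult K hK hodd hpd hinert hsplit⟩

end Shimura

end Summit.BirchSwinnertonDyer.BirchSwinnertonDyer.Theorems.AdditiveKoly.RamifiedHabitat

end
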